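import Summits.Ventures.HSemireg.SiegelComponentChart
import Summits.Ventures.HSemireg.ComponentTransferUnion
import Literature.AlgebraicGeometry.HodgeTheory.BlochSemiregularSpreadOfSubschemeGlobal
import HarnessLib

/-!
# Venture HSemireg — the chain on `𝒜_{g,δ,N}` for REDUCIBLE and ARBITRARY local-complete-intersection representatives
# (composition: theory seat 3's `SiegelComponentChart.lean` × the reducible-lci facts of `UnionSeed.lean` / `SubschemeSeed.lean`)

HONEST FRAMING. Assembly file of the computation cell `pub-hsemireg` (Lean seat p3, composition duty); nothing is claimed
about any variety and nothing here says that HC / HC_CM / HC_AV holds — every theorem carries its inputs BY NAME.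
`SiegelComponentChart.lean` (th-3) proves the 𝒜_g-form of the chain «a Bloch-semiregular INTEGRAL lci supporting
`a·α₀ + b·Λ|_{t₀}` at ONE point `(t₀, α₀)` of a component `C` of the locus of Hodge classes of the universal family
⟹ `α` algebraic for every `(t, α) ∈ C`», modulo the chart assumption `SiegelHodgeLocusChart g δ N` and the named fact
`BlochSemiregularSpread g p`. The cell's certified STEP-0 object is REDUCIBLE (Schoen's `Δ_J ∪ (C × C)`), and its Prong-C
objects (`T₁ ∪ ζT₁ ∪ ζ²T₁ ⊂ J(C)²`) may have singular components; this file re-runs th-3's proof verbatim with the two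
reducible-lci transport facts:

* `hc_on_siegelComponent_of_unionSeed_of_smul_add` — `Z` REDUCED with SMOOTH components `K_j ↪ 𝒴_{t₀}`,
  `a·α₀ + b·Λ|_{t₀} = μ·Σ_j ι_{j*}1` (`a, μ ∈ ℚ^×`), fact `BlochSemiregularSpreadSmoothComponents g p` (through its GLOBAL
  form `blochSemiregularSpreadSmoothComponents_forall_mem_algebraicClasses` of `ComponentTransferUnion.lean`).
* `hc_on_siegelComponent_of_subschemeSeed_of_smul_add` — `Z` ANY lci, `a·α₀ + b·Λ|_{t₀} = μ·[Z]` with `[Z]` the tree's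
  REAL `subschemeClass` (literature seat lit-1), fact `BlochSemiregularSpreadOfSubscheme g p` (through
  `BlochSemiregularSpreadOfSubscheme.forall_mem_algebraicClasses`).

Trust bases per door (all transport facts REFEREED — Bloch 1972 (7.4)/(7.5), Buchweitz–Flenner 2003 Thm. 5.2 — and the
chart ASSUMPTION `SiegelHodgeLocusChart`, assembled from CDK 1995 / Hironaka / Deligne 1971 by th-3): see the docstrings.
Not here: the sheaf door on `𝒜_g` (needs the chart's pulled-back polarization powers as the companion classes `ch_p`,
`p ∈ I ∖ {n}`; the Weil-family forms of `SheafSeed.lean` cover the cell's use).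

References: [Bloch1972Semiregularity] Thm. (7.4), Remark (7.5), p. 65; [BuchweitzFlenner2003] Thm. 5.2;
[CattaniDeligneKaplan1995JAMS] Thm. 1.1, Cor. 1.2; [DeligneHodgeII1971] Thm. 4.1.1; [Fulton1998] §1.5, §19.1.
-/

noncomputable section

open CategoryTheory AlgebraicGeometry Set
open Literature.AlgebraicGeometry.Motives Literature.AlgebraicGeometry.HodgeTheory
open Literature.AlgebraicGeometry.ModuliOfAbelianVarieties Literature.AlgebraicGeometry.Deligne1982
open Literature.AlgebraicTopology.SingularHomology

namespace Summit.Ventures.HSemireg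

local notation3 (prettyPrint := false) "Res[" f ", " s ", " k ", " A "]" =>
  complexBetti.map (Literature.AlgebraicGeometry.Motives.fiberι f s) k A

section Siegel

variable {g : ℕ} {δ : Fin g → ℕ} {N : ℕ}

/-- **The chain on 𝒜_{g,δ,N}, Remark (7.5) form, for a REDUCED lci with SMOOTH components** (the STEP-0 class (A) shape).
Granted `SiegelHodgeLocusChart g δ N` (th-3's chart assumption) and `BlochSemiregularSpreadSmoothComponents g p` (Bloch
(7.4)/(7.5) for such `Z`, refereed named fact): let `Λ` be a global class of the universal family, fibrewise rational
`(p,p)` and fibrewise algebraic (a power of the relative polarisation), `C` a component of the locus of Hodge classes,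
`(t₀, α₀) ∈ C`, and on the fibre `𝒴_{t₀}` (smooth projective of dimension `g`, witness `hX₀`) smooth projective `m`-folds
`K_j ↪ 𝒴_{t₀}` (`m + p = g`, pairwise distinct images) whose union carries a REDUCED Bloch-semiregular lci `Z` of
codimension `p`, with `a·α₀ + b·Λ|_{t₀} = μ·Σ_j ι_{j*}1`, `a, μ ∈ ℚ^×`. Then `α` is algebraic for EVERY `(t, α) ∈ C`.
Proof = th-3's `hc_on_siegelComponent_of_semiregular_of_smul_add` with the global class `μ⁻¹·(a·W + b·Φ^*Λ)` and the
global form of the reducible fact. [cite: Bloch1972Semiregularity, Thm. (7.4) and Remark (7.5), p. 65]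
[cite: BuchweitzFlenner2003, Thm. 5.2] [cite: CattaniDeligneKaplan1995JAMS, Thm. 1.1 and Cor. 1.2] -/
theorem hc_on_siegelComponent_of_unionSeed_of_smul_add (hA : SiegelHodgeLocusChart g δ N) {p : ℕ}
    (hB : BlochSemiregularSpreadSmoothComponents g p) (D : SiegelModuliDatum g δ N) (C : HodgeLocusComponent D.f g p)
    (Λ : complexBetti D.𝒳 (2 * p))
    (hΛ : ∀ s : ComplexPoints D.S, IsRationalClass (Res[D.f, s, 2 * p, Λ]) ∧
      IsOfHodgeType g (fiberOver D.f s) (2 * p) p p (Res[D.f, s, 2 * p, Λ]))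
    (hΛalg : ∀ s : ComplexPoints D.S, Res[D.f, s, 2 * p, Λ] ∈ algebraicClasses (fiberOver D.f s) p)
    {x₀ : FiberClass D.f (2 * p)} (hx₀ : x₀ ∈ C.carrier) (a b : ℚ) (ha : a ≠ 0)
    (hX₀ : IsSmoothProjective g (fiberOver D.f x₀.pt)) {m : ℕ} (hmn : m + p = g)
    {r : ℕ} (K : Fin r → SchemeOver ℂ) (hK : ∀ j, IsSmoothProjective m (K j)) (ι : ∀ j, K j ⟶ fiberOver D.f x₀.pt)
    (hι : ∀ j, IsClosedImmersion (ι j).left)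
    (hdist : ∀ j j', Set.range (ι j).left.base = Set.range (ι j').left.base → j = j')
    {Z : Scheme.{0}} (i : Z ⟶ (fiberOver D.f x₀.pt).left) (hreg : IsRegularImmersionOfCodim i p) (hred : IsReduced Z)
    (hrange : Set.range i.base = ⋃ j, Set.range (ι j).left.base) (hsr : IsBlochSemiregular i g p) (μ : ℚ) (hμ : μ ≠ 0)
    (hcls : (a : ℂ) • x₀.cls + (b : ℂ) • Res[D.f, x₀.pt, 2 * p, Λ] =
      ((μ : ℚ) : ℂ) • ∑ j, smoothSubvarietyClass hmn (hK j) hX₀ (ι j)) :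
    ∀ x ∈ C.carrier, x.cls ∈ algebraicClasses (fiberOver D.f x.pt) p := by
  obtain ⟨𝒳, T, f, Φ, W, hf, h𝒳, hT, hTs, hTi, hW, hΦ, hsw⟩ := hA D p C
  haveI := hTi
  -- the pulled-back class `L = Φ^*Λ` and its fibrewise properties (every chart fibre is a fibre of `D.f`)
  set L : complexBetti 𝒳 (2 * p) := complexBetti.map Φ (2 * p) Λ with hLdef
  have hLfib : ∀ u : ComplexPoints T, (IsRationalClass (Res[f, u, 2 * p, L]) ∧
      IsOfHodgeType g (fiberOver f u) (2 * p) p p (Res[f, u, 2 * p, L])) ∧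
      Res[f, u, 2 * p, L] ∈ algebraicClasses (fiberOver f u) p := by
    intro u
    obtain ⟨s, e, he⟩ := hΦ u
    have hres : Res[f, u, 2 * p, L] = complexBetti.map e.hom (2 * p) (Res[D.f, s, 2 * p, Λ]) := by
      rw [hLdef, map_res_eq_res_map_of_comm e he]
    rw [hres]
    exact ⟨⟨(isRationalClass_map_iff_of_iso e).2 (hΛ s).1, (isOfHodgeType_map_iff_of_iso e).2 (hΛ s).2⟩,
      (mem_algebraicClasses_map_iff_of_iso e).2 (hΛalg s)⟩
  -- the special point on the chart and the rescaled combined global class `V' = μ⁻¹·(a·W + b·L)`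
  obtain ⟨u₀, e₀, he₀Φ, he₀⟩ := hsw x₀ hx₀
  set V : complexBetti 𝒳 (2 * p) := (a : ℂ) • W + (b : ℂ) • L with hVdef
  have hVres : ∀ u : ComplexPoints T, Res[f, u, 2 * p, V] =
      (a : ℂ) • Res[f, u, 2 * p, W] + (b : ℂ) • Res[f, u, 2 * p, L] := fun u => by
    simp only [hVdef, map_add, map_smul]
  have hVhodge : ∀ u : ComplexPoints T, IsRationalClass (Res[f, u, 2 * p, V]) ∧
      IsOfHodgeType g (fiberOver f u) (2 * p) p p (Res[f, u, 2 * p, V]) := fun u => by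
    rw [hVres u]
    exact ⟨((hW u).1.smul a).add ((hLfib u).1.1.smul b),
      ((hW u).2.smul (a : ℂ)).add (hf.isSmoothProjective u) ((hLfib u).1.2.smul (b : ℂ))⟩
  set V' : complexBetti 𝒳 (2 * p) := ((μ⁻¹ : ℚ) : ℂ) • V with hV'def
  have hV'res : ∀ u : ComplexPoints T, Res[f, u, 2 * p, V'] = ((μ⁻¹ : ℚ) : ℂ) • Res[f, u, 2 * p, V] := fun u => by
    rw [hV'def, map_smul]
  have hV'hodge : ∀ u : ComplexPoints T, IsRationalClass (Res[f, u, 2 * p, V']) ∧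
      IsOfHodgeType g (fiberOver f u) (2 * p) p p (Res[f, u, 2 * p, V']) := fun u => by
    rw [hV'res u]
    exact ⟨(hVhodge u).1.smul μ⁻¹, (hVhodge u).2.smul _⟩
  have hVx : complexBetti.map e₀.symm.hom (2 * p) (Res[f, u₀, 2 * p, V]) =
      (a : ℂ) • x₀.cls + (b : ℂ) • Res[D.f, x₀.pt, 2 * p, Λ] := by
    rw [hVres u₀, ← he₀, hLdef, ← map_res_eq_res_map_of_comm e₀ he₀Φ, Iso.symm_hom, map_add, map_smul, map_smul,
      e₀.complexBetti_map_inv_map_hom, e₀.complexBetti_map_inv_map_hom]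
  have hV'x : complexBetti.map e₀.symm.hom (2 * p) (Res[f, u₀, 2 * p, V']) =
      ∑ j, smoothSubvarietyClass hmn (hK j) hX₀ (ι j) := by
    rw [hV'res u₀, map_smul, hVx, hcls, smul_smul, ← Rat.cast_mul, inv_mul_cancel₀ hμ, Rat.cast_one, one_smul]
  -- Bloch (reduced lci, smooth components), GLOBAL on the irreducible chart
  have hV'all : ∀ u : ComplexPoints T, Res[f, u, 2 * p, V'] ∈ algebraicClasses (fiberOver f u) p :=
    blochSemiregularSpreadSmoothComponents_forall_mem_algebraicClasses hB
      charlesSchnell_algebraicityLocus_iUnion_closed_holds m hmn (fiberOver D.f x₀.pt) hX₀ r K hK ι Z i f u₀ e₀.symm V'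
      hι hdist hreg hred hrange hsr hf h𝒳 hT hTs hV'hodge hV'x
  have hVall : ∀ u : ComplexPoints T, Res[f, u, 2 * p, V] ∈ algebraicClasses (fiberOver f u) p := by
    intro u
    have h := Submodule.smul_mem _ ((μ : ℚ) : ℂ) (hV'all u)
    rwa [hV'res u, smul_smul, ← Rat.cast_mul, mul_inv_cancel₀ hμ, Rat.cast_one, one_smul] at h
  have ha' : (a : ℂ) ≠ 0 := by exact_mod_cast ha
  have hWalg : ∀ u : ComplexPoints T, Res[f, u, 2 * p, W] ∈ algebraicClasses (fiberOver f u) p := by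
    intro u
    have h1 : (a : ℂ) • Res[f, u, 2 * p, W] ∈ algebraicClasses (fiberOver f u) p := by
      have := Submodule.sub_mem _ (hVall u) (Submodule.smul_mem _ (b : ℂ) (hLfib u).2)
      rwa [hVres u, add_sub_cancel_right] at this
    have h2 := Submodule.smul_mem _ (a : ℂ)⁻¹ h1
    rwa [smul_smul, inv_mul_cancel₀ ha', one_smul] at h2
  have hsweep : SweepsClasses D.f f W C.carrier := fun x hx => by
    obtain ⟨u, e, -, he⟩ := hsw x hx
    exact ⟨u, e, he⟩
  exact fun x hx => hsweep.mem_algebraicClasses hWalg hx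

/-- **The chain on 𝒜_{g,δ,N}, Remark (7.5) form, for an ARBITRARY lci subscheme** (singular components, multiplicities
allowed — the Prong-C shape). Granted `SiegelHodgeLocusChart g δ N` and `BlochSemiregularSpreadOfSubscheme g p` (Bloch
(7.4)/BF Thm. 5.2 for any lci subscheme, refereed named fact, literature seat lit-1): with `Λ` as above, `(t₀, α₀) ∈ C`,
a resolution family `ρ` of `𝒴_{t₀}` in dimension `d` (`d + p = g`), a closed lci `i : Z ↪ 𝒴_{t₀}` of codimension `p`
(`Z` locally Noetherian, pure, `[Z] ∈ Z_d(𝒴_{t₀})`), Bloch-semiregular, with `a·α₀ + b·Λ|_{t₀} = μ·[Z]`, `[Z]` the REAL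
fundamental class `subschemeClass hX₀ hdp ρ i hi`, `a, μ ∈ ℚ^×`: `α` is algebraic for EVERY `(t, α) ∈ C`.
[cite: Bloch1972Semiregularity, Thm. (7.4) and Remark (7.5), p. 65] [cite: BuchweitzFlenner2003, Thm. 5.2]
[cite: Fulton1998, §1.5 and §19.1] [cite: CattaniDeligneKaplan1995JAMS, Thm. 1.1 and Cor. 1.2] -/
theorem hc_on_siegelComponent_of_subschemeSeed_of_smul_add (hA : SiegelHodgeLocusChart g δ N) {p : ℕ}
    (hB : BlochSemiregularSpreadOfSubscheme g p) (D : SiegelModuliDatum g δ N) (C : HodgeLocusComponent D.f g p)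
    (Λ : complexBetti D.𝒳 (2 * p))
    (hΛ : ∀ s : ComplexPoints D.S, IsRationalClass (Res[D.f, s, 2 * p, Λ]) ∧
      IsOfHodgeType g (fiberOver D.f s) (2 * p) p p (Res[D.f, s, 2 * p, Λ]))
    (hΛalg : ∀ s : ComplexPoints D.S, Res[D.f, s, 2 * p, Λ] ∈ algebraicClasses (fiberOver D.f s) p)
    {x₀ : FiberClass D.f (2 * p)} (hx₀ : x₀ ∈ C.carrier) (a b : ℚ) (ha : a ≠ 0)
    (hX₀ : IsSmoothProjective g (fiberOver D.f x₀.pt)) {d : ℕ} (hdp : d + p = g)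
    (ρ : ResolutionFamily (fiberOver D.f x₀.pt) d)
    {Z : Scheme.{0}} (i : Z ⟶ (fiberOver D.f x₀.pt).left) [IsLocallyNoetherian Z] (hi : IsClosedImmersion i)
    (hreg : IsRegularImmersionOfCodim i p) (hcodim : ∀ z ∈ Set.range i.base, (p : ℕ∞) ≤ Order.coheight z)
    (hsr : IsBlochSemiregular i g p) (hmem : subschemeCycle i hi ∈ cyclesOfDim (fiberOver D.f x₀.pt).left d)
    (μ : ℚ) (hμ : μ ≠ 0)
    (hcls : (a : ℂ) • x₀.cls + (b : ℂ) • Res[D.f, x₀.pt, 2 * p, Λ] =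
      ((μ : ℚ) : ℂ) • subschemeClass hX₀ hdp ρ i hi) :
    ∀ x ∈ C.carrier, x.cls ∈ algebraicClasses (fiberOver D.f x.pt) p := by
  obtain ⟨𝒳, T, f, Φ, W, hf, h𝒳, hT, hTs, hTi, hW, hΦ, hsw⟩ := hA D p C
  haveI := hTi
  set L : complexBetti 𝒳 (2 * p) := complexBetti.map Φ (2 * p) Λ with hLdef
  have hLfib : ∀ u : ComplexPoints T, (IsRationalClass (Res[f, u, 2 * p, L]) ∧
      IsOfHodgeType g (fiberOver f u) (2 * p) p p (Res[f, u, 2 * p, L])) ∧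
      Res[f, u, 2 * p, L] ∈ algebraicClasses (fiberOver f u) p := by
    intro u
    obtain ⟨s, e, he⟩ := hΦ u
    have hres : Res[f, u, 2 * p, L] = complexBetti.map e.hom (2 * p) (Res[D.f, s, 2 * p, Λ]) := by
      rw [hLdef, map_res_eq_res_map_of_comm e he]
    rw [hres]
    exact ⟨⟨(isRationalClass_map_iff_of_iso e).2 (hΛ s).1, (isOfHodgeType_map_iff_of_iso e).2 (hΛ s).2⟩,
      (mem_algebraicClasses_map_iff_of_iso e).2 (hΛalg s)⟩
  obtain ⟨u₀, e₀, he₀Φ, he₀⟩ := hsw x₀ hx₀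
  set V : complexBetti 𝒳 (2 * p) := (a : ℂ) • W + (b : ℂ) • L with hVdef
  have hVres : ∀ u : ComplexPoints T, Res[f, u, 2 * p, V] =
      (a : ℂ) • Res[f, u, 2 * p, W] + (b : ℂ) • Res[f, u, 2 * p, L] := fun u => by
    simp only [hVdef, map_add, map_smul]
  have hVhodge : ∀ u : ComplexPoints T, IsRationalClass (Res[f, u, 2 * p, V]) ∧
      IsOfHodgeType g (fiberOver f u) (2 * p) p p (Res[f, u, 2 * p, V]) := fun u => by
    rw [hVres u]
    exact ⟨((hW u).1.smul a).add ((hLfib u).1.1.smul b),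
      ((hW u).2.smul (a : ℂ)).add (hf.isSmoothProjective u) ((hLfib u).1.2.smul (b : ℂ))⟩
  set V' : complexBetti 𝒳 (2 * p) := ((μ⁻¹ : ℚ) : ℂ) • V with hV'def
  have hV'res : ∀ u : ComplexPoints T, Res[f, u, 2 * p, V'] = ((μ⁻¹ : ℚ) : ℂ) • Res[f, u, 2 * p, V] := fun u => by
    rw [hV'def, map_smul]
  have hV'hodge : ∀ u : ComplexPoints T, IsRationalClass (Res[f, u, 2 * p, V']) ∧
      IsOfHodgeType g (fiberOver f u) (2 * p) p p (Res[f, u, 2 * p, V']) := fun u => by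
    rw [hV'res u]
    exact ⟨(hVhodge u).1.smul μ⁻¹, (hVhodge u).2.smul _⟩
  have hVx : complexBetti.map e₀.symm.hom (2 * p) (Res[f, u₀, 2 * p, V]) =
      (a : ℂ) • x₀.cls + (b : ℂ) • Res[D.f, x₀.pt, 2 * p, Λ] := by
    rw [hVres u₀, ← he₀, hLdef, ← map_res_eq_res_map_of_comm e₀ he₀Φ, Iso.symm_hom, map_add, map_smul, map_smul,
      e₀.complexBetti_map_inv_map_hom, e₀.complexBetti_map_inv_map_hom]
  have hV'x : complexBetti.map e₀.symm.hom (2 * p) (Res[f, u₀, 2 * p, V']) = subschemeClass hX₀ hdp ρ i hi := by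
    rw [hV'res u₀, map_smul, hVx, hcls, smul_smul, ← Rat.cast_mul, inv_mul_cancel₀ hμ, Rat.cast_one, one_smul]
  -- Bloch (arbitrary lci), GLOBAL on the irreducible chart
  have hV'all : ∀ u : ComplexPoints T, Res[f, u, 2 * p, V'] ∈ algebraicClasses (fiberOver f u) p :=
    BlochSemiregularSpreadOfSubscheme.forall_mem_algebraicClasses hB charlesSchnell_algebraicityLocus_iUnion_closed_holds
      (fiberOver D.f x₀.pt) Z i _ f u₀ e₀.symm V' hX₀ d hdp ρ hi hreg hcodim hsr hmem rfl hf h𝒳 hT hTs hV'hodge hV'x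
  have hVall : ∀ u : ComplexPoints T, Res[f, u, 2 * p, V] ∈ algebraicClasses (fiberOver f u) p := by
    intro u
    have h := Submodule.smul_mem _ ((μ : ℚ) : ℂ) (hV'all u)
    rwa [hV'res u, smul_smul, ← Rat.cast_mul, mul_inv_cancel₀ hμ, Rat.cast_one, one_smul] at h
  have ha' : (a : ℂ) ≠ 0 := by exact_mod_cast ha
  have hWalg : ∀ u : ComplexPoints T, Res[f, u, 2 * p, W] ∈ algebraicClasses (fiberOver f u) p := by
    intro u
    have h1 : (a : ℂ) • Res[f, u, 2 * p, W] ∈ algebraicClasses (fiberOver f u) p := by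
      have := Submodule.sub_mem _ (hVall u) (Submodule.smul_mem _ (b : ℂ) (hLfib u).2)
      rwa [hVres u, add_sub_cancel_right] at this
    have h2 := Submodule.smul_mem _ (a : ℂ)⁻¹ h1
    rwa [smul_smul, inv_mul_cancel₀ ha', one_smul] at h2
  have hsweep : SweepsClasses D.f f W C.carrier := fun x hx => by
    obtain ⟨u, e, -, he⟩ := hsw x hx
    exact ⟨u, e, he⟩
  exact fun x hx => hsweep.mem_algebraicClasses hWalg hx

end Siegel

end Summit.Ventures.HSemireg

end
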